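import Summits.AtomisticToContinuum.FouriersLaw.Theorems.OddSectorIrreversibilityConeScaleCorrectorStubConeTransportBudgetContraction

/-!
# `ConeScaleCorrector` (E1), line `GlueInnerCone`: the fixed-`N` content of FD2 `stub_postCrossingMinkowskiTail`

Helpers for crux stmt-AtomisticToContinuum-14069 (`--supports`). The registered N-uniform stub FD2 asks for
`a, C` with `∫_{(aN,∞)} √A_N(t) dt ≤ C·N·√Z` for ALL `N`, `A_N(t) = ‖P_tJ_tot‖²_{L²(μ_T)}`
(`OddSectorLocality.forecastNormSq`), together with the honesty conjunct `IntegrableOn √A_N (aN, ∞)`.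
This file proves the FIXED-`N` version outright, isolating the `N`-uniformity of `C` as the entire content
of the stub: by the equilibrium Harris bound (CEHR 2018 (2.5), `pinnedChain_harris_bound`) the forecast of
the centred observable `J_tot` decays pointwise, `|P_tJ(z)| ≤ K C_J e^{H(z)/(4T)} e^{-ct}`, so
`A_N(t) ≤ B_N e^{-2ct}` (`forecastNormSq_le_mul_exp_neg`), `√A_N` is integrable on every `(A, ∞)`
(`integrableOn_sqrt_forecastNormSq_Ioi`) and `∫_{(A,∞)} √A_N ≤ √B_N / c` for `A ≥ 0`
(`exists_setIntegral_sqrt_forecastNormSq_Ioi_le`). The constants `B_N, c` come from the fixed-`N` ergodic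
theory and carry no information on `N`.
-/

noncomputable section

open MeasureTheory ProbabilityTheory Filter Topology Set
open scoped ENNReal NNReal BigOperators
open Literature.MathematicalPhysics.KineticTheory.HeatConduction
open Literature.MathematicalPhysics.KineticTheory.OddSectorLocality

namespace Summit.AtomisticToContinuum.FouriersLaw.Theorems.OddSectorIrreversibility

open Summit.AtomisticToContinuum.FouriersLaw.Theorems.LightConeBondHeat

variable {N : ℕ} {ω₂ lam β γ T : ℝ}

/-- **Fixed-`N` exponential decay of the forecast curve**: there are `B ≥ 0` and `c > 0` (depending on
`N` and the parameters) with `A_N(t) ≤ B e^{-2ct}` for every real `t` (for `t ≤ 0` the clamp `t⁺ = 0` makes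
the bound trivial-but-true since `e^{-2ct} ≥ 1`). Harris bound for the centred `J_tot` squared and
integrated against `μ_T = Z • gibbsMeasure`, using `e^{H/(2T)} ∈ L¹(gibbsMeasure)`. [folklore] -/
theorem forecastNormSq_le_mul_exp_neg (hω : 0 < ω₂) (hl : 0 ≤ lam) (hβ : 0 < β) (hγ : 0 < γ) (hT : 0 < T)
    (N : ℕ) :
    ∃ B c : ℝ, 0 ≤ B ∧ 0 < c ∧ ∀ t : ℝ, forecastNormSq ω₂ lam β γ T N t ≤ B * Real.exp (-(2 * c) * t) := by
  rcases Nat.eq_zero_or_pos N with rfl | hN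
  · refine ⟨0, 1, le_rfl, one_pos, fun t => ?_⟩
    have h0 : ∀ x : PhaseSpace 0, currentForecast ω₂ lam β γ T 0 t x = 0 := fun x => by
      simp only [currentForecast, Finset.univ_eq_empty, Finset.sum_empty, integral_zero]
    simp only [forecastNormSq, h0, zero_pow two_ne_zero, integral_zero, zero_mul, le_refl]
  · obtain ⟨hϑ0, h2ϑ⟩ := quarter_inv_temp_admissible hT
    have hϑ1 : 1 / (4 * T) < 1 / T := by linarith
    obtain ⟨K, c, hK, hc, hb⟩ := pinnedChain_harris_bound hω hl hβ hγ hN hT hϑ0 hϑ1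
    have hJc := continuous_totalBondCurrent ω₂ lam β γ N
    have hJb := abs_totalBondCurrent_le_exp hω.le hl hβ.le γ N hϑ0
    have hJ0 := integral_totalBondCurrent_gibbsMeasure hω hl hβ.le γ N hT
    set CJ : ℝ := N * (N * ((3 + β) / 2) * (2 * Real.exp (1 / (4 * T)) / (1 / (4 * T)) ^ 2)) with hCJ
    have hCJ0 : 0 ≤ CJ := by have := hβ.le; positivity
    -- the integrable dominator `e^{2ϑH}` on `μ_T = Z • gibbsMeasure`
    set Z := (pinnedChain ω₂ lam β γ).partitionFunction N T with hZ
    have hZtop : Z ≠ ∞ := (pinnedChain ω₂ lam β γ).partitionFunction_ne_top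
      (pinnedChain_integrable_gibbsDensity hω hl hβ.le γ N hT)
    have hμ : gibbsWeight ω₂ lam β γ T N = Z • (pinnedChain ω₂ lam β γ).gibbsMeasure N T :=
      gibbsWeight_eq_smul_gibbsMeasure hω hl hβ.le γ N hT
    have h2ϑ' : 2 * (1 / (4 * T)) < 1 / T := h2ϑ
    have hexpI : Integrable (fun x => Real.exp (2 * (1 / (4 * T)) * (pinnedChain ω₂ lam β γ).hamiltonian N x))
        (gibbsWeight ω₂ lam β γ T N) := by
      rw [hμ]
      exact (pinnedChain_integrable_exp_mul_hamiltonian_gibbsMeasure hω hl hβ.le γ N hT h2ϑ').smul_measure hZtop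
    set I : ℝ := ∫ x, Real.exp (2 * (1 / (4 * T)) * (pinnedChain ω₂ lam β γ).hamiltonian N x)
      ∂(gibbsWeight ω₂ lam β γ T N) with hI
    have hI0 : 0 ≤ I := integral_nonneg fun _ => (Real.exp_pos _).le
    refine ⟨(K * CJ) ^ 2 * I, c, by positivity, hc, fun t => ?_⟩
    -- pointwise bound on the squared forecast
    have hpt : ∀ x : PhaseSpace N, (currentForecast ω₂ lam β γ T N t x) ^ 2 ≤
        (K * CJ) ^ 2 * Real.exp (-(2 * c) * t) *
          Real.exp (2 * (1 / (4 * T)) * (pinnedChain ω₂ lam β γ).hamiltonian N x) := by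
      intro x
      have h1 : |currentForecast ω₂ lam β γ T N t x| ≤
          K * CJ * Real.exp (1 / (4 * T) * (pinnedChain ω₂ lam β γ).hamiltonian N x) * Real.exp (-c * t) :=
        centred_abs_act_le hK.le hb hc hJc hCJ0 hJb hJ0 x t
      have h0 : 0 ≤ K * CJ * Real.exp (1 / (4 * T) * (pinnedChain ω₂ lam β γ).hamiltonian N x) *
          Real.exp (-c * t) := by positivity
      calc (currentForecast ω₂ lam β γ T N t x) ^ 2 = |currentForecast ω₂ lam β γ T N t x| ^ 2 :=
            (sq_abs _).symm
        _ ≤ (K * CJ * Real.exp (1 / (4 * T) * (pinnedChain ω₂ lam β γ).hamiltonian N x) *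
              Real.exp (-c * t)) ^ 2 := pow_le_pow_left₀ (abs_nonneg _) h1 2
        _ = (K * CJ) ^ 2 * Real.exp (-(2 * c) * t) *
              Real.exp (2 * (1 / (4 * T)) * (pinnedChain ω₂ lam β γ).hamiltonian N x) := by
            rw [show ∀ a b e : ℝ, (a * b * e) ^ 2 = a ^ 2 * (e * e) * (b * b) from fun a b e => by ring,
              ← Real.exp_add, ← Real.exp_add]
            congr 2 <;> ring_nf
    calc forecastNormSq ω₂ lam β γ T N t
        ≤ ∫ x, (K * CJ) ^ 2 * Real.exp (-(2 * c) * t) *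
            Real.exp (2 * (1 / (4 * T)) * (pinnedChain ω₂ lam β γ).hamiltonian N x)
            ∂(gibbsWeight ω₂ lam β γ T N) :=
          integral_mono_of_nonneg (Eventually.of_forall fun x => sq_nonneg _) (hexpI.const_mul _)
            (Eventually.of_forall hpt)
      _ = (K * CJ) ^ 2 * I * Real.exp (-(2 * c) * t) := by
          rw [integral_const_mul, hI]; ring

/-- **`√A_N` is integrable on every `(A, ∞)` at fixed `N`** — the honesty conjunct of FD2 holds for every
`N` (with nothing `N`-uniform claimed). [folklore] -/
theorem integrableOn_sqrt_forecastNormSq_Ioi (hω : 0 < ω₂) (hl : 0 ≤ lam) (hβ : 0 < β) (hγ : 0 < γ)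
    (hT : 0 < T) (N : ℕ) (A : ℝ) :
    IntegrableOn (fun t => Real.sqrt (forecastNormSq ω₂ lam β γ T N t)) (Ioi A) := by
  obtain ⟨B, c, hB, hc, hle⟩ := forecastNormSq_le_mul_exp_neg hω hl hβ hγ hT N
  refine Integrable.mono' (((exp_neg_integrableOn_Ioi A hc).const_mul (Real.sqrt B)))
    ((measurable_forecastNormSq hω hl hβ.le hγ.le T N).sqrt.aestronglyMeasurable)
    (Eventually.of_forall fun t => ?_)
  rw [Real.norm_eq_abs, abs_of_nonneg (Real.sqrt_nonneg _)]
  calc Real.sqrt (forecastNormSq ω₂ lam β γ T N t) ≤ Real.sqrt (B * Real.exp (-(2 * c) * t)) :=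
        Real.sqrt_le_sqrt (hle t)
    _ = Real.sqrt B * Real.exp (-c * t) := by
        have he : Real.exp (-(2 * c) * t) = Real.exp (-c * t) ^ 2 := by
          rw [sq, ← Real.exp_add]; ring_nf
        rw [Real.sqrt_mul hB, he, Real.sqrt_sq (Real.exp_pos _).le]

/-- **FD2 at fixed `N`**: for every `N` there is `D` (depending on `N`) with
`∫_{(A,∞)} √A_N(t) dt ≤ D` for every `A ≥ 0` — so the registered N-uniform stub
`stub_postCrossingMinkowskiTail` (`… ≤ C·N·√Z` for ALL `N`) is a statement about the `N`-dependence of the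
post-crossing memory of the total current and nothing else. [folklore] -/
theorem exists_setIntegral_sqrt_forecastNormSq_Ioi_le (hω : 0 < ω₂) (hl : 0 ≤ lam) (hβ : 0 < β)
    (hγ : 0 < γ) (hT : 0 < T) (N : ℕ) :
    ∃ D : ℝ, 0 ≤ D ∧ ∀ A : ℝ, 0 ≤ A →
      IntegrableOn (fun t => Real.sqrt (forecastNormSq ω₂ lam β γ T N t)) (Ioi A) ∧
        ∫ t in Ioi A, Real.sqrt (forecastNormSq ω₂ lam β γ T N t) ≤ D := by
  obtain ⟨B, c, hB, hc, hle⟩ := forecastNormSq_le_mul_exp_neg hω hl hβ hγ hT N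
  have hdom : ∀ t : ℝ, Real.sqrt (forecastNormSq ω₂ lam β γ T N t) ≤ Real.sqrt B * Real.exp (-c * t) := by
    intro t
    calc Real.sqrt (forecastNormSq ω₂ lam β γ T N t) ≤ Real.sqrt (B * Real.exp (-(2 * c) * t)) :=
          Real.sqrt_le_sqrt (hle t)
      _ = Real.sqrt B * Real.exp (-c * t) := by
          have he : Real.exp (-(2 * c) * t) = Real.exp (-c * t) ^ 2 := by
            rw [sq, ← Real.exp_add]; ring_nf
          rw [Real.sqrt_mul hB, he, Real.sqrt_sq (Real.exp_pos _).le]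
  refine ⟨Real.sqrt B * (1 / c), by positivity, fun A hA => ⟨integrableOn_sqrt_forecastNormSq_Ioi hω hl hβ hγ hT N A, ?_⟩⟩
  have hI0 := integrableOn_sqrt_forecastNormSq_Ioi hω hl hβ hγ hT N 0
  calc ∫ t in Ioi A, Real.sqrt (forecastNormSq ω₂ lam β γ T N t)
      ≤ ∫ t in Ioi (0 : ℝ), Real.sqrt (forecastNormSq ω₂ lam β γ T N t) :=
        setIntegral_mono_set hI0 (Eventually.of_forall fun t => Real.sqrt_nonneg _)
          (Ioi_subset_Ioi hA).eventuallyLE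
    _ ≤ ∫ t in Ioi (0 : ℝ), Real.sqrt B * Real.exp (-c * t) :=
        setIntegral_mono_on hI0 ((exp_neg_integrableOn_Ioi 0 hc).const_mul _) measurableSet_Ioi
          (fun t _ => hdom t)
    _ = Real.sqrt B * (1 / c) := by
        rw [integral_const_mul]
        congr 1
        simpa only [neg_mul] using integral_exp_neg_mul_Ioi hc

/-! ### The registered fixed-`N` sub-goal of FD2 proved by this file -/

/-- **Sub-goal `stub_postCrossingMinkowskiTail_fixedN` of FD2** (registered on stmt-AtomisticToContinuum-14069):
at every FIXED `N` the post-crossing Minkowski tail is finite — `√A_N` is integrable on every `(A, ∞)` and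
`∫_{(A,∞)} √A_N ≤ D_N` for `A ≥ 0` — with a constant `D_N` from the fixed-`N` Harris bound. The registered
N-uniform stub FD2 is the assertion `D_N ≤ C·N·√Z` from `A = aN` on, uniformly in `N`. [folklore] -/
theorem stub_postCrossingMinkowskiTail_fixedN :
    ∀ ω₂ lam β γ : ℝ, 0 < ω₂ → 0 ≤ lam → 0 < β → 0 < γ → ∀ T : ℝ, 0 < T → ∀ N : ℕ, ∃ D : ℝ, 0 ≤ D ∧ ∀ A : ℝ, 0 ≤ A → MeasureTheory.IntegrableOn (fun t : ℝ => Real.sqrt (Literature.MathematicalPhysics.KineticTheory.OddSectorLocality.forecastNormSq ω₂ lam β γ T N t)) (Set.Ioi A) ∧ ∫ t in Set.Ioi A, Real.sqrt (Literature.MathematicalPhysics.KineticTheory.OddSectorLocality.forecastNormSq ω₂ lam β γ T N t) ≤ D :=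
  fun _ _ _ _ hω hl hβ hγ _ hT N => exists_setIntegral_sqrt_forecastNormSq_Ioi_le hω hl hβ hγ hT N

end Summit.AtomisticToContinuum.FouriersLaw.Theorems.OddSectorIrreversibility
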